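import Summits.MatrixMultiplication.MatrixMultiplication.Theorems.EdgePencilBimaximal
import HarnessLib

/-!
# `DMaxBlind ⟺ FirstOrderFree`: the sight of the diamond-maximisers is the first-order slope of the ladder
# (a Danskin-type identity from the compactness of `X₄`)

Support kernel for `stmt-MatrixMultiplication-26697` (`TetraExcessZero : ω(K₄) ≤ ω(2,1,2) =: ψ`, route
`TetrahedronCarving`; cut of record `closes (TetraExcessZero) (TetraPlusTwo) : ω = 2`, UNCHANGED; lineage
`decomp-mm-lens-6`, generation 45; sequel of `EdgePencilBimaximal`). No item is added or changed; no definition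
is introduced. Notation as there (`X₄(F)`, `[t]`, `W_n^{(e)}`, `D_n`, `P_e`, `χ`, `ψ`, `T`, `p_φ = log₂ φ[P_2]`,
`d_φ = log₂ φ[D_2]`), and the two inline statements

* `DMaxBlind : ∀ φ ∈ X₄(F), d_φ = ψ → p_φ = 0` (every diamond-maximal point is blind; `EdgePencilBimaximal`),
* `FirstOrderFree : ∀ ε > 0 ∃ δ ∈ (0,1], χ(δ) ≤ ψ + εδ` (the hypothesis of
  `EdgePencilSixthConvexity.excessZero_of_firstOrderFree_of_noKink`; `SixRungPos ⟹ FirstOrderFree` there).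

§36 `DMaxBlind ⟺ FirstOrderFree` (`firstOrderFree_of_dMaxBlind`, `dMaxBlind_of_firstOrderFree`,
`dMaxBlind_iff_firstOrderFree`). (⟹) is proved from the COMPACTNESS of `X₄` in the topology of pointwise
convergence (`DTensorClass.isCompact_asymptoticSpectrumDTensors`, Zuiddam 2018 Thm. 2.15): the `ε`-seeing points
`S_ε = {φ ∈ X₄ : φ[P_2] ≥ 2^ε}` form a compact set (closed condition on one continuous coordinate) on which the
continuous coordinate `φ ↦ φ[D_2]` attains its maximum, which is `< 2^ψ` by `DMaxBlind` — a UNIFORM GAP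
`d_φ ≤ ψ − γ` on `S_ε`; at the rung scale `δ = 1/k ≤ γ/2` (base `2^k`, thickness `2`) the maximiser of `d + δp`
(`exists_coord_eq_omegaSix`) is either outside `S_ε` (`p < ε`, value `< ψ + εδ`) or inside (`value ≤ ψ − γ/2`),
so `χ(1/k) ≤ ψ + ε/k`. (⟸) a seeing diamond-maximal point (`d_φ = ψ`, `p_φ > 0`) lies under the ladder at every
log-rational slope `j/k` (`coord_le_omegaSix`, base `2^k`, thickness `2^j`): `χ(j/k) ≥ ψ + (j/k) p_φ`; with
`j/k ∈ [δ/2, δ]` (`exists_rat_mem_half`) this contradicts `χ(δ) ≤ ψ + (p_φ/4)δ`. Consequently the chain of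
first stubs of the line `rung_and_chord` reads `SixRungPos ⟹ FirstOrderFree ⟺ DMaxBlind`, and
`EdgePencilSixthConvexity.excessZero_of_firstOrderFree_of_noKink` is the bimaximal split
`EdgePencilBimaximal.excessZero_iff_dMaxBlind_and_midTight` read through `midTight_iff_noKink`.

References: Zuiddam 2018, Thm. 2.15, Cor. 2.13 [Zuiddam2018]; Strassen 1988, Thm. 3.8 [Strassen1988];
Christandl–Vrana–Zuiddam 2023, Thm. 1.1 [ChristandlVranaZuiddam2023]. No `sorry`, no new axiom, no instance, no
notation, no definition.
-/

noncomputable section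

set_option linter.dupNamespace false

open Filter Finset Literature.Computability.AlgebraicComplexity
open Summit.MatrixMultiplication.MatrixMultiplication.Theorems.TetrahedronTensor
open Summit.MatrixMultiplication.MatrixMultiplication.Theorems.TetraDiagonal
open Summit.MatrixMultiplication.MatrixMultiplication.Theses.TetrahedronCarving

namespace Summit.MatrixMultiplication.MatrixMultiplication.Theorems.EdgePencil

/-! ## §36a Log-rationals in `[δ/2, δ]` -/

section Slopes

/-- **Log-rationals are dense enough**: for `δ ∈ (0,1]` some `j/k` (`1 ≤ j ≤ k`) lies in `[δ/2, δ]`. [folklore] -/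
theorem exists_rat_mem_half {δ : ℝ} (hδ0 : 0 < δ) (hδ1 : δ ≤ 1) :
    ∃ j k : ℕ, 1 ≤ j ∧ j ≤ k ∧ δ / 2 ≤ (j : ℝ) / k ∧ (j : ℝ) / k ≤ δ := by
  obtain ⟨k, hk⟩ := exists_nat_ge (2 / δ)
  have hk0 : (0 : ℝ) < k := lt_of_lt_of_le (by positivity) hk
  have hδk : 2 ≤ δ * k := by
    rw [div_le_iff₀ hδ0] at hk
    linarith
  refine ⟨⌊δ * k⌋₊, k, Nat.le_floor (by rw [Nat.cast_one]; linarith), ?_, ?_, ?_⟩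
  · have h : (⌊δ * k⌋₊ : ℝ) ≤ k := (Nat.floor_le (by positivity)).trans (mul_le_of_le_one_left hk0.le hδ1)
    exact_mod_cast h
  · rw [le_div_iff₀ hk0]
    have := Nat.lt_floor_add_one (δ * k)
    linarith
  · rw [div_le_iff₀ hk0]
    exact Nat.floor_le (by positivity)

end Slopes

/-! ## §36 `DMaxBlind ⟺ FirstOrderFree` (compactness of `X₄`) -/

section Danskin

variable (F : Type) [Field F]

/-- **`DMaxBlind ⟹ FirstOrderFree`** (Danskin direction, from the compactness of `X₄`): if every
diamond-maximal point is blind then `∀ ε > 0 ∃ δ ∈ (0,1], χ(δ) ≤ ψ + εδ`. [cite: Zuiddam2018, Thm. 2.15] -/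
theorem firstOrderFree_of_dMaxBlind
    (hB : ∀ φ ∈ DTensorClass.asymptoticSpectrumDTensors F 2,
      Real.logb 2 (φ (DTensorClass.mk (sixTetra F 2 1))) = omegaRect F 2 1 2 →
        Real.logb 2 (φ (DTensorClass.mk (fun i : Fin 4 → Fin 2 => (ind (i 0 = i 1) : F)))) = 0)
    {ε : ℝ} (hε : 0 < ε) :
    ∃ δ : ℝ, 0 < δ ∧ δ ≤ 1 ∧ omegaSix F δ ≤ omegaRect F 2 1 2 + ε * δ := by
  -- Step 1: a uniform diamond gap `γ` for the `ε`-seeing points (a compact set).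
  have key : ∃ γ : ℝ, 0 < γ ∧ ∀ φ ∈ DTensorClass.asymptoticSpectrumDTensors F 2,
      (2 : ℝ) ^ ε ≤ φ (DTensorClass.mk (fun i : Fin 4 → Fin 2 => (ind (i 0 = i 1) : F))) →
        Real.logb 2 (φ (DTensorClass.mk (sixTetra F 2 1))) ≤ omegaRect F 2 1 2 - γ := by
    set S : Set (DTensorClass F 4 → ℝ) := DTensorClass.asymptoticSpectrumDTensors F 2 ∩
      {φ | (2 : ℝ) ^ ε ≤ φ (DTensorClass.mk (fun i : Fin 4 → Fin 2 => (ind (i 0 = i 1) : F)))} with hS_def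
    have hS : IsCompact S :=
      DTensorClass.isCompact_asymptoticSpectrumDTensors.inter_right
        (isClosed_le continuous_const (continuous_apply _))
    by_cases hne : S.Nonempty
    · obtain ⟨φ₀, hφ₀S, hmax⟩ := hS.exists_isMaxOn hne
        (f := fun φ : DTensorClass F 4 → ℝ => φ (DTensorClass.mk (sixTetra F 2 1)))
        (continuous_apply _).continuousOn
      have hφ₀ : φ₀ ∈ DTensorClass.asymptoticSpectrumDTensors F 2 := hφ₀S.1
      have hP₀ : (2 : ℝ) ^ ε ≤ φ₀ (DTensorClass.mk (fun i : Fin 4 → Fin 2 => (ind (i 0 = i 1) : F))) := hφ₀S.2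
      have hP₀pos : 0 < φ₀ (DTensorClass.mk (fun i : Fin 4 → Fin 2 => (ind (i 0 = i 1) : F))) :=
        one_pos.trans_le (one_le_spectrum_pair (by norm_num) hφ₀)
      have hp₀ : ε ≤ Real.logb 2 (φ₀ (DTensorClass.mk (fun i : Fin 4 → Fin 2 => (ind (i 0 = i 1) : F)))) :=
        (Real.le_logb_iff_rpow_le one_lt_two hP₀pos).2 hP₀
      have hd₀ : Real.logb 2 (φ₀ (DTensorClass.mk (sixTetra F 2 1))) < omegaRect F 2 1 2 := by
        refine lt_of_le_of_ne (coord_diamond_mem F hφ₀).2 fun h => ?_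
        have := hB φ₀ hφ₀ h
        linarith
      refine ⟨omegaRect F 2 1 2 - Real.logb 2 (φ₀ (DTensorClass.mk (sixTetra F 2 1))), sub_pos.2 hd₀,
        fun φ hφ hP => ?_⟩
      have hle : φ (DTensorClass.mk (sixTetra F 2 1)) ≤ φ₀ (DTensorClass.mk (sixTetra F 2 1)) := hmax ⟨hφ, hP⟩
      have hD1 : 1 ≤ φ (DTensorClass.mk (sixTetra F 2 1)) := one_le_spectrum_sixTetra (by norm_num) le_rfl hφ
      have := Real.logb_le_logb_of_le one_lt_two (by linarith) hle
      linarith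
    · exact ⟨1, one_pos, fun φ hφ hP => absurd ⟨φ, hφ, hP⟩ hne⟩
  obtain ⟨γ, hγ, hgap⟩ := key
  -- Step 2: the rung scale `δ = 1/k ≤ γ/2`, base `2^k`, thickness `2`.
  obtain ⟨k, hk⟩ := exists_nat_ge (2 / γ)
  have hk0 : (0 : ℝ) < k := lt_of_lt_of_le (by positivity) hk
  have hkpos : 0 < k := by exact_mod_cast hk0
  have hkγ : 1 / (k : ℝ) ≤ γ / 2 := by
    rw [div_le_iff₀ hγ] at hk
    rw [div_le_iff₀ hk0]
    linarith
  have hn2 : 2 ≤ 2 ^ k := Nat.one_lt_two_pow_iff.2 (by omega)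
  have hlog : Real.logb ((2 ^ k : ℕ) : ℝ) ((2 : ℕ) : ℝ) = 1 / k := by
    have h := logb_two_pow_two_pow 1 k
    rw [pow_one, Nat.cast_one] at h
    push_cast
    exact h
  refine ⟨1 / k, by positivity, (div_le_one hk0).2 (by exact_mod_cast hkpos), ?_⟩
  obtain ⟨φ, hφ, hφeq⟩ := exists_coord_eq_omegaSix F (n := 2 ^ k) (e := 2) hn2 (by norm_num) hn2
  rw [hlog] at hφeq
  rw [← hφeq]
  obtain ⟨hp0, hp1⟩ := coord_pair_mem hφ
  obtain ⟨-, hdψ⟩ := coord_diamond_mem F hφ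
  have hεk : 0 ≤ ε * (1 / k) := by positivity
  by_cases hP : (2 : ℝ) ^ ε ≤ φ (DTensorClass.mk (fun i : Fin 4 → Fin 2 => (ind (i 0 = i 1) : F)))
  · -- a seeing maximiser is gapped: `d ≤ ψ − γ`, `p/k ≤ 1/k ≤ γ/2`
    have hd := hgap φ hφ hP
    have hpk : 1 / (k : ℝ) * Real.logb 2 (φ (DTensorClass.mk (fun i : Fin 4 → Fin 2 => (ind (i 0 = i 1) : F))))
        ≤ 1 / k := mul_le_of_le_one_right (by positivity) hp1
    linarith
  · -- a non-seeing maximiser has `p < ε`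
    rw [not_le] at hP
    have hPpos : 0 < φ (DTensorClass.mk (fun i : Fin 4 → Fin 2 => (ind (i 0 = i 1) : F))) :=
      one_pos.trans_le (one_le_spectrum_pair (by norm_num) hφ)
    have hp : Real.logb 2 (φ (DTensorClass.mk (fun i : Fin 4 → Fin 2 => (ind (i 0 = i 1) : F)))) < ε :=
      (Real.logb_lt_iff_lt_rpow one_lt_two hPpos).2 hP
    have hpk : 1 / (k : ℝ) * Real.logb 2 (φ (DTensorClass.mk (fun i : Fin 4 → Fin 2 => (ind (i 0 = i 1) : F))))
        ≤ 1 / k * ε := mul_le_mul_of_nonneg_left hp.le (by positivity)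
    linarith [mul_comm ε (1 / (k : ℝ))]

/-- **`FirstOrderFree ⟹ DMaxBlind`**: a seeing diamond-maximal point `(p_φ > 0, d_φ = ψ)` props the ladder up
to `χ(δ) ≥ ψ + δ p_φ/2` at every `δ ∈ (0,1]` (via a log-rational `j/k ∈ [δ/2, δ]`, base `2^k`, thickness
`2^j`), contradicting first-order vanishing with `ε = p_φ/4`. [cite: Strassen1988, Thm. 3.8] -/
theorem dMaxBlind_of_firstOrderFree
    (hfree : ∀ ε : ℝ, 0 < ε → ∃ δ : ℝ, 0 < δ ∧ δ ≤ 1 ∧ omegaSix F δ ≤ omegaRect F 2 1 2 + ε * δ) :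
    ∀ φ ∈ DTensorClass.asymptoticSpectrumDTensors F 2,
      Real.logb 2 (φ (DTensorClass.mk (sixTetra F 2 1))) = omegaRect F 2 1 2 →
        Real.logb 2 (φ (DTensorClass.mk (fun i : Fin 4 → Fin 2 => (ind (i 0 = i 1) : F)))) = 0 := by
  intro φ hφ hd
  obtain ⟨hp0, -⟩ := coord_pair_mem hφ
  by_contra hne
  have hp : 0 < Real.logb 2 (φ (DTensorClass.mk (fun i : Fin 4 → Fin 2 => (ind (i 0 = i 1) : F)))) :=
    lt_of_le_of_ne hp0 (Ne.symm hne)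
  obtain ⟨δ, hδ0, hδ1, hδ⟩ := hfree _ (div_pos hp four_pos)
  obtain ⟨j, k, hj1, hjk, hlo, hhi⟩ := exists_rat_mem_half hδ0 hδ1
  have hn2 : 2 ≤ 2 ^ k := Nat.one_lt_two_pow_iff.2 (by omega)
  have he1 : 1 ≤ 2 ^ j := Nat.one_le_two_pow
  have he : 2 ^ j ≤ 2 ^ k := Nat.pow_le_pow_right (by norm_num) hjk
  have hc := coord_le_omegaSix F (n := 2 ^ k) (e := 2 ^ j) hn2 he1 he hφ
  have hlog : Real.logb ((2 ^ k : ℕ) : ℝ) ((2 ^ j : ℕ) : ℝ) = (j : ℝ) / k := by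
    push_cast
    exact logb_two_pow_two_pow j k
  rw [hlog, hd] at hc
  have hmono := omegaSix_mono F hhi
  have h1 : δ / 2 * Real.logb 2 (φ (DTensorClass.mk (fun i : Fin 4 → Fin 2 => (ind (i 0 = i 1) : F)))) ≤
      (j : ℝ) / k * Real.logb 2 (φ (DTensorClass.mk (fun i : Fin 4 → Fin 2 => (ind (i 0 = i 1) : F)))) :=
    mul_le_mul_of_nonneg_right hlo hp0
  nlinarith [mul_pos hδ0 hp]

/-- **`DMaxBlind ⟺ FirstOrderFree`.** [cite: Zuiddam2018, Thm. 2.15] -/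
theorem dMaxBlind_iff_firstOrderFree :
    (∀ φ ∈ DTensorClass.asymptoticSpectrumDTensors F 2,
      Real.logb 2 (φ (DTensorClass.mk (sixTetra F 2 1))) = omegaRect F 2 1 2 →
        Real.logb 2 (φ (DTensorClass.mk (fun i : Fin 4 → Fin 2 => (ind (i 0 = i 1) : F)))) = 0) ↔
      ∀ ε : ℝ, 0 < ε → ∃ δ : ℝ, 0 < δ ∧ δ ≤ 1 ∧ omegaSix F δ ≤ omegaRect F 2 1 2 + ε * δ :=
  ⟨fun hB _ hε => firstOrderFree_of_dMaxBlind F hB hε, dMaxBlind_of_firstOrderFree F⟩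

end Danskin

/-- **By name over `ℂ`**: `TetraExcessZero ⟺ FirstOrderFree ∧ MidTight` — the registered line with its first
stub replaced by first-order vanishing of the ladder. [cite: LottiRomani1983, §2 (p. 174)] -/
theorem tetraExcessZero_iff_firstOrderFree_and_midTight :
    TetraExcessZero ↔
      (∀ ε : ℝ, 0 < ε → ∃ δ : ℝ, 0 < δ ∧ δ ≤ 1 ∧ omegaSix ℂ δ ≤ omegaRect ℂ 2 1 2 + ε * δ) ∧
        omegaRect ℂ 2 1 2 + omegaTetra ℂ ≤ 2 * omegaSix ℂ (1 / 2) := by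
  rw [tetraExcessZero_iff_dMaxBlind_and_midTight, dMaxBlind_iff_firstOrderFree ℂ]

/-- **NEC**: `ω = 2 ⟹ FirstOrderFree` over `ℂ`. [cite: Strassen1988, Thm. 3.8] -/
theorem firstOrderFree_of_matrixMultiplication (hS : _root_.MatrixMultiplication) {ε : ℝ} (hε : 0 < ε) :
    ∃ δ : ℝ, 0 < δ ∧ δ ≤ 1 ∧ omegaSix ℂ δ ≤ omegaRect ℂ 2 1 2 + ε * δ :=
  firstOrderFree_of_dMaxBlind ℂ (dMaxBlind_of_matrixMultiplication hS) hε

end Summit.MatrixMultiplication.MatrixMultiplication.Theorems.EdgePencil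

end
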